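import Literature.AlgebraicGeometry.Resolution.Dehomogenization
import Mathlib.RingTheory.MvPolynomial.Homogeneous
import HarnessLib

/-!
# NRA-A run reading, FILE 3a: **forms are determined by their dehomogenisation; homogenising an affine-linear polynomial**
# (pure polynomial algebra; Theses-free, def-free)

OURS (campaign `res-hironaka`, rung L ★L-G4, slot W4.1 · crux `Steer` (stmt-ResolutionOfSingularities-16345) · hARᵒ H2, residue word NRA-A; RULING
284(b)(3); plan `D/res-D-repro-2/NRA-A-RUNREADING-PLAN.md` FILE 3 step (b); seat res-D-repro-2 g9). Over Literature `dehomogenize`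
(`coeff_dehomogenize_of_isHomogeneous`, `dehomogenize_ne_zero_of_isHomogeneous`). Not a statement of the manuscript under review [claim: Hironaka2017,
status: under-review]; AI-produced, weaker than expert review.

* `eq_of_dehomogenize_eq` — two forms of the same degree with the same dehomogenisation are equal.
* `exists_linearForm_dehomogenize_eq` — a polynomial `λ` of total degree `≤ 1` in the variables `T_j (j ≠ i)` is the dehomogenisation of a LINEAR
  FORM `M` (homogeneous of degree `1`) in all variables: `M := λ(0)·X_i + Σ_j (∂λ/∂T_j)·X_j`.
[folklore]
-/

noncomputable section

set_option linter.dupNamespace false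

open MvPolynomial

namespace Summit.ResolutionOfSingularities.ResolutionOfSingularities.Theorems.SwitchingDichotomy.NonRationalWindow

open Literature.AlgebraicGeometry.Resolution

variable {R : Type*} [CommRing R] {σ : Type*} [DecidableEq σ] (i : σ)

/-- **Forms are determined by their dehomogenisation.** [folklore] -/
theorem eq_of_dehomogenize_eq {Φ₁ Φ₂ : MvPolynomial σ R} {n : ℕ} (h₁ : Φ₁.IsHomogeneous n) (h₂ : Φ₂.IsHomogeneous n)
    (h : dehomogenize i Φ₁ = dehomogenize i Φ₂) : Φ₁ = Φ₂ := by
  by_contra hne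
  have hsub : (Φ₁ - Φ₂).IsHomogeneous n := h₁.sub h₂
  have h0 : dehomogenize i (Φ₁ - Φ₂) = 0 := by rw [map_sub, h, sub_self]
  exact dehomogenize_ne_zero_of_isHomogeneous i hsub (sub_ne_zero.mpr hne) h0

/-- **Homogenising an affine-linear polynomial.** For `λ ∈ R[T_j : j ≠ i]` of total degree `≤ 1` there is a linear form `M ∈ R[X_σ]`
(homogeneous of degree `1`) with `M(X_i := 1) = λ`. [folklore] -/
theorem exists_linearForm_dehomogenize_eq (lam : MvPolynomial {j : σ // j ≠ i} R) (hlam : lam.totalDegree ≤ 1) :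
    ∃ M : MvPolynomial σ R, M.IsHomogeneous 1 ∧ dehomogenize i M = lam := by
  classical
  -- uniform homogenisation of an exponent of degree ≤ 1: `α ↦ α + (1 − |α|)·e_i`
  let homog : ({j : σ // j ≠ i} →₀ ℕ) → (σ →₀ ℕ) := fun α =>
    α.mapDomain Subtype.val + Finsupp.single i (1 - (α.mapDomain Subtype.val).degree)
  have hdeg : ∀ α ∈ lam.support, α.degree ≤ 1 := by
    intro α hα
    have := MvPolynomial.le_totalDegree hα
    rw [Finsupp.degree_apply]
    exact this.trans hlam
  have hsub : ∀ α : {j : σ // j ≠ i} →₀ ℕ, (homog α).subtypeDomain (· ≠ i) = α := by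
    intro α
    ext k
    simp only [homog, Finsupp.subtypeDomain_apply, Finsupp.coe_add, Pi.add_apply,
      Finsupp.mapDomain_apply Subtype.val_injective, Finsupp.single_apply]
    rw [if_neg (Ne.symm k.2), add_zero]
  refine ⟨∑ α ∈ lam.support, monomial (homog α) (coeff α lam), ?_, ?_⟩
  · -- homogeneous of degree 1
    refine MvPolynomial.IsHomogeneous.sum _ _ _ fun α hα => ?_
    refine isHomogeneous_monomial _ ?_
    simp only [homog, map_add, Finsupp.degree_single, Finsupp.degree_mapDomain]
    have := hdeg α hα
    omega
  · -- dehomogenisation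
    rw [map_sum]
    conv_rhs => rw [lam.as_sum]
    refine Finset.sum_congr rfl fun α _ => ?_
    rw [dehomogenize_monomial, hsub]

end Summit.ResolutionOfSingularities.ResolutionOfSingularities.Theorems.SwitchingDichotomy.NonRationalWindow

end
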